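import Literature.Computability.Complexity.Williams2014ConvFP2
import Literature.Computability.Complexity.Williams2014ConvBounds
import Literature.Computability.Complexity.Williams2014Lemma41Reduction
import Literature.Computability.Complexity.Williams2014PreprocFinal
import HarnessLib

/-!
# Williams (2014), Lemma 4.1, Theorem 4.1 and the ACC-SAT algorithm — discharged

R. Williams, *Nonuniform ACC circuit lower bounds*, J. ACM 61 (2014): the conversion of `ACC`
circuits into `SYM⁺` circuits in quasi-polynomial time (**Lemma 4.1**, after Beigel–Tarui and
Allender–Gore, Appendix A), the evaluation of `SYM⁺` circuits on all inputs (Lemma 4.2, the tree's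
`Williams2014_lemma_4_2_holds`) and their combination, the `2^{n - n^ε}`-time ACC-SAT algorithm
(**Theorem 4.1**, its polynomial-size consequence `Williams2014_accSat_polysize` drawn in the proof of
Theorem 1.1, p. 18, and the sharpened form `MurrayWilliams2018_thm_5_1`).

`Williams2014_lemma_4_1_holds` closes the named fact `Williams2014_lemma_4_1` by the padding reduction
`Williams2014_lemma_4_1_of_FP` (`Williams2014Lemma41Reduction.lean`) from:

* the explicit conversion `S := BT.accSymPlus d m hm` with its size / fan-in / correctness clause
  `BT.accSymPlus_spec` (`Williams2014Collapse.lean`: Valiant–Vazirani isolation with explicit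
  pairwise-independent seeds, Beigel–Tarui modulus amplification, monomial expansion);
* the polynomial-time string function of `BT.convOnCodes_code d m` (`Williams2014ConvFP2.lean`), which
  on the padded code `qpClock c₁ e₁ (encodeAccCircuit m C)` returns `listE natE (convCodeB d m B …)`;
* the budget lemma `BT.convCodeB_eq_convCode` (`Williams2014ConvCap.lean`) under `CapFits d m B C`,
  supplied by the quasi-polynomial bounds `BT.capFits_of_le` and `BT.pad_suffices`
  (`Williams2014ConvBounds.lean`), and the code identity `BT.convCode_eq` (`Williams2014ConvCode.lean`).

Then `Williams2014_thm_4_1_holds`, `Williams2014_accSat_polysize_holds` and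
`MurrayWilliams2018_thm_5_1_holds` follow from the assembly theorems of `Williams2014PreprocFinal.lean`.
No new named fact; 0 sorry.

## References

* R. Williams, *Nonuniform ACC circuit lower bounds*, J. ACM 61 (2014) 2:1–2:32, Lemma 4.1, Lemma 4.2,
  Theorem 4.1, proof of Theorem 1.1, Appendix A [Williams2014].
* C. Murray, R. Williams, *Circuit lower bounds for nondeterministic quasi-polytime*, STOC 2018,
  Theorem 5.1 [MurrayWilliams2018].
* R. Beigel, J. Tarui, *On ACC*, Comput. Complexity 4 (1994) [BeigelTarui1994].
-/

namespace Literature.Computability.Complexity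

open CodeFP SatCode

/-- The padded circuit code is the typed code of the pair (code list, budget). [folklore] -/
theorem qpClock_encodeAccCircuit (c e m : ℕ) {n : ℕ} (C : Circuit (Fin n)) :
    qpClock c e (encodeAccCircuit m C) = pairE (listE natE) unE (circuitCodeList m C,
      c * (encodeAccCircuit m C).length ^ Nat.log 2 (encodeAccCircuit m C).length ^ e + c) := by
  rw [qpClock, pairE_apply, unE_eq_ones, ← encodeAccCircuit_eq_listE]

/-- Deserialising a circuit code gives its components. [folklore] -/
theorem deserialize'_circuitCodeList (m : ℕ) {n : ℕ} (C : Circuit (Fin n)) :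
    (deserialize' (circuitCodeList m C)).2 = (n, wireC C.output, BT.gcodes m C) := by
  rw [circuitCodeList_eq_serialize, deserialize'_of_some (deserialize_serialize _ _ _)]

/-- `encodeSymPlus = listE natE ∘ symPlusCodeList`. [folklore] -/
theorem encodeSymPlus_eq_listE {n : ℕ} (S : SymPlus n) : encodeSymPlus S = listE natE (symPlusCodeList S) := by
  rw [encodeSymPlus, encode_listNat_eq_listE]

/-- **Williams (2014), Lemma 4.1** (after Beigel–Tarui / Allender–Gore): the quasi-polynomial-time
conversion of `ACC` circuits into equivalent `SYM⁺` circuits, as the named fact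
`Williams2014_lemma_4_1` of `Williams2014AccSat.lean` — discharged.
[cite: Williams2014, Lemma 4.1 and Appendix A] -/
theorem Williams2014_lemma_4_1_holds : Williams2014_lemma_4_1 := by
  refine Williams2014_lemma_4_1_of_FP fun d m hm => ?_
  obtain ⟨c₁, e₁, hpad⟩ := BT.pad_suffices (BT.Ebig d m)
  obtain ⟨f, hf, hfeq⟩ := BT.convOnCodes_code d m
  refine ⟨fun {n} C => BT.accSymPlus d m hm C, BT.eConv d m, c₁, e₁, f, hf, ?_, ?_⟩
  · intro n s C hC hd _ hsize hfan
    exact BT.accSymPlus_spec d m hm C hC hd hsize hfan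
  · intro n C hC hd
    rw [qpClock_encodeAccCircuit, hfeq, encodeSymPlus_eq_listE]
    dsimp only
    rw [deserialize'_circuitCodeList, BT.convCodeB_eq_convCode (BT.capFits_of_le hm C hC d hd (hpad _)),
      BT.convCode_eq hm C hC d hd]

/-- **Williams (2014), Theorem 4.1**: satisfiability of depth-`d` `ACC` circuits with `n` inputs and
`2^{n^ε}` size is decidable in `2^{n - Ω(n^δ)}` time, `δ > ε` — the named fact `Williams2014_thm_4_1`,
discharged. [cite: Williams2014, Thm. 4.1] -/
theorem Williams2014_thm_4_1_holds : Williams2014_thm_4_1 :=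
  Williams2014_thm_4_1_of_lemma_4_1 Williams2014_lemma_4_1_holds

/-- **Williams (2014), Theorem 4.1 at polynomial size** ("the Circuit SAT algorithm of Theorem 4.1 can
determine satisfiability of any `n + c log n` input, `n^c` size ACC circuit in `O(2^{n - log² n})` time",
proof of Theorem 1.1, p. 18): the ACC-SAT algorithm for polynomial-size circuits beating exhaustive
search — the named fact `Williams2014_accSat_polysize`, discharged.
[cite: Williams2014, Thm. 4.1 and proof of Thm. 1.1] -/
theorem Williams2014_accSat_polysize_holds : Williams2014_accSat_polysize :=
  Williams2014_accSat_polysize_of_lemma_4_1 Williams2014_lemma_4_1_holds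

/-- **Murray–Williams (2018), Theorem 5.1** (the ACC-SAT algorithm in the form used by the easy witness
lemma for `NQP`) — the named fact `MurrayWilliams2018_thm_5_1`, discharged.
[cite: MurrayWilliams2018, Theorem 5.1] -/
theorem MurrayWilliams2018_thm_5_1_holds : MurrayWilliams2018_thm_5_1 :=
  MurrayWilliams2018_thm_5_1_of_lemma_4_1 Williams2014_lemma_4_1_holds

end Literature.Computability.Complexity
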